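import Summits.Schanuel.Schanuel.Theorems.RootDecomp1ResidueSieveFourExp
import Literature.NumberTheory.Transcendental.SixExponentialsProofs

/-!
# Root decomposition, lens 1 («grading / quantitative ladder»), round 17 — THE CONJUGATE SIEVE:
# six exponentials + complex conjugation decide item D on the σ-balanced power planes

Cell `decomp-schanuel`, lens 1, generation 17 (planner seat `decomp-schanuel-lens-1-g17`).  Item of record:
`stmt-Schanuel-30353` = `Summit.Schanuel.Schanuel.Theses.RootDecomp1.DisjointSaturatedEssentialSchanuel` (D,
the disjoint stratum `ε = 0` of the saturated essential non-rational core, `n ≥ 3`).  Round 16 («residue sieve»)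
left D at length 3 on the residue `Cell(1,1) ∪ Cell(2,0)` and showed that on the ARG-RICH POWER PLANES
`z = y₀·(1, ρ, ρ²)` (`y₀, ρ` algebraically independent) D follows from the FOUR EXPONENTIALS CONJECTURE (FEC) — the
values `e^{y₀}, e^{y₀ρ}, e^{y₀ρ}, e^{y₀ρ²}` are a `2 × 2` exponential grid.  FEC is open.

**This round's instrument (new in the tree for item D): the `2 × 3` grid hidden in `V + σV`** (`sigmaGrid_not_all_algebraic`;
in FEC format: `fourExponentials_of_conj_axes`, a PROVED CASE of the registered `FourExponentialsConjecture` —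
`x ⊂ ℝ ∪ iℝ` ℚ-free and `(y₁, y₂, conj y₁)` ℚ-free).  Complex
conjugation `σ` preserves algebraicity of values (`e^{conj u} = conj e^u`, `Complex.exp_conj`), so «all three values
of `z` algebraic» forces «all values on `span_ℚ(z) + σ span_ℚ(z)` algebraic».  Whenever that `σ`-saturated span
contains a grid `xᵢyⱼ` (`x ∈ ℂ²`, `y ∈ ℂ³` both ℚ-free) the PROVED six exponentials theorem
(`Literature.NumberTheory.Transcendental.six_exponentials_holds`, sorry-free in the tree) is contradicted.  This is
G. Diaz' observation [Diaz2004, Théorème 1 and its «variante», pp. 537–538: the four exponentials conjecture HOLDS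
for ℚ-free `x₁, x₂ ∈ ℝ ∪ iℝ` and `y ∉ ℝ` with `Re y ∉ ℚ`, by six exponentials on `(x₁, x₂) × (1, y, ȳ)`], transplanted from
Schneider's problem to the cells of item D.  Two families of arg-rich power planes are `σ`-BALANCED in this sense
and item D becomes a THEOREM on them (no FEC, no Nesterenko, nothing open):

* **F_R (real or imaginary multiplier).** `conj ρ = ±ρ`, `(y₀, y₀ρ, conj y₀)` ℚ-free (for real `ρ` this is exactly
  «`y₀ ∉ ℝ ∪ iℝ`», `linearIndependent_triple_of_oblique`): grid `(1, ρ) × (y₀, y₀ρ, conj y₀)`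
  (`exists_transcendental_exp_powerPlane_of_conj`).  Member `z_e = e^{i}·(1, e, e²) = (e^{i}, e^{1+i}, e^{2+i})`,
  certified by Lindemann–Weierstrass alone (`member_zE`); by-product: ONE OF `exp(e^{i}), exp(e^{1+i}),
  exp(e^{2+i})` IS TRANSCENDENTAL (`exists_transcendental_exp_exp_I`).
* **F_U (unimodular multiplier `ρ = conj y₀ / y₀`).** `(y₀, conj y₀)` and `(1, ρ, conj ρ)` ℚ-free: grid
  `(y₀, conj y₀) × (1, ρ, conj ρ)` — Diaz' variant verbatim (`diaz_conj_variant`,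
  `exists_transcendental_exp_powerPlane_unimodular`).  Member `z_u = (e^{1-i}, e^{1+i}, e^{1+3i}) =
  e^{1-i}·(1, e^{2i}, e^{4i})` (`member_zU`), again Lindemann–Weierstrass only.

On both families `a = trdeg ℚ(z) = 2` (arg-rich), `v = trdeg ℚ(e^z) ≥ 1` (the sieve), `ε = 0` (D's binder), so the
additive certificate of round 15 gives `3 ≤ trdeg ℚ(z, e^z)`: **D is DECIDED (holds) at `z_e` and `z_u` by theorem,
on the disjoint stratum; Schanuel at `z_e`, `z_u` stays OPEN** (it is the statement `3 ≤ trdeg ℚ(e, e^{i}, exp e^{i},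
exp e^{1+i}, exp e^{2+i})`, resp. its `z_u` analogue, displayed as `schanuel_at_zE_iff`; nobody knows `ε = 0` there).
The item form with the binders of stmt-30353 verbatim is `disjointSaturatedEssentialSchanuel_powerPlane_sigma`
(HYPOTHESIS-FREE — compare round 16's `…_powerPlane_of_fourExp (hF : FourExponentialsConjecture)`).

**Residue map v3 (power-plane part).** arg-rich power planes = F_R ∪ F_U (D a THEOREM, this file) ∪ σ-RIGID planes
(both `y₀(1,ρ,ρ²)` and its conjugate generate only a `2 × 2` grid: totally real/imaginary planes such as round 16's
`z_F = e^π(1, π, π²)`, and oblique `ρ ∉ ℝ ∪ iℝ ∪ (conj y₀/y₀)·ℚ…`; D ⟸ FEC there, round 16, untouched).  The grade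
that tells the sub-cells apart is the CONJUGATE RANK `κ(z) = dim_ℚ (V + σV)` together with the position of `σV`
(`κ = 6` on F_R, `κ = 4` on F_U, `κ = 3` on σ-stable planes = the H-mirror territory of 1H, not this item's).

Hygiene: no `sorry`, no new `def … : Prop`, no instances/notation; `powerPlane` and the §0 toolkit are restated from
round 16 (`RootDecomp1ResidueSieve.lean`, port pending) so that this file elaborates against the tree as it stands.

References: [Diaz2004] G. Diaz, «Utilisation de la conjugaison complexe dans l'étude de la transcendance de valeurs
de la fonction exponentielle», J. Théor. Nombres Bordeaux 16 (2004) 535–553, doi:10.5802/jtnb.459, Thm 1 + variante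
pp. 537–538 [corpus: paper:doi-10-5802-jtnb-459 p.3–4]; [Waldschmidt2000] M. Waldschmidt, Diophantine Approximation
on Linear Algebraic Groups, Grundlehren 326, §1.3 (six exponentials), §1.4 (four exponentials conjecture);
[Lang1966] S. Lang, Introduction to Transcendental Numbers, Ch. II §1 Thm 1 (six exponentials);
[BakerTNT1975] A. Baker, Transcendental Number Theory, Ch. 1 Thm 1.4 (Lindemann–Weierstrass).
-/

noncomputable section

namespace Summit.Schanuel.Schanuel.Theorems.RootDecomp1ConjugateSieve

open Complex IntermediateField Module Polynomial
open scoped ComplexConjugate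
open Literature.NumberTheory.Transcendental (exists_nsmul_mem_span_int six_exponentials_holds
  transcendental_exp_holds algebraicIndependent_exp_holds linearIndependent_exp_holds FourExponentialsConjecture)
open Summit.Schanuel.Schanuel.Theorems.RootDecomp1EAnchor (isAlgebraic_of_mem_adjoin trdeg_adjoin_le_of_isAlgebraic
  trdeg_adjoin_le_nat)
open Summit.Schanuel.Schanuel.Theorems.RootDecomp1EEStableRung (one_le_trdeg_adjoin_of_transcendental)
open Summit.Schanuel.Schanuel.Theorems.RootDecomp1ArgumentCells (le_trdeg_of_algebraicIndependent_mem)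
open Summit.Schanuel.Schanuel.Theorems.RootDecomp1ResidueSieve (powerPlane powerPlane_zero powerPlane_one powerPlane_two
  two_le_argDegree_powerPlane)
open Summit.Schanuel.Schanuel.Theorems.RootDecomp1AdditiveCells (le_trdeg_of_additive_cert)
open Summit.Schanuel.Schanuel.Theorems.RootDecomp1AdditiveCellsD (pair_one_linearIndependent)
open Summit.Schanuel.Schanuel.Theorems.RootDecomp1ValueCells (exp_mem_vals_of_mem_span_int)

/-! ## §0  Toolkit (restated from rounds 15/16, whose files are not all ported into `Theorems/` yet) -/

/-- A transcendental number is non-zero. -/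
private theorem ne_zero_of_transcendental {w : ℂ} (hw : Transcendental ℚ w) : w ≠ 0 := by
  rintro rfl
  exact hw isAlgebraic_zero

/-- Linear independence over `ℚ̄ = algebraicClosure ℚ ℂ` descends to `ℚ`. -/
theorem linearIndependent_rat_of_algClosure {ι : Type*} {v : ι → ℂ}
    (h : LinearIndependent (algebraicClosure ℚ ℂ) v) : LinearIndependent ℚ v :=
  h.restrict_scalars' ℚ

/-- A transcendental value among the three gives value degree `≥ 1`. -/
theorem one_le_valDegree_of_exists {n : ℕ} (z : Fin n → ℂ) (h : ∃ k, Transcendental ℚ (cexp (z k))) :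
    (1 : Cardinal) ≤ Algebra.trdeg ℚ ↥(adjoin ℚ (Set.range (cexp ∘ z))) := by
  obtain ⟨k, hk⟩ := h
  exact one_le_trdeg_adjoin_of_transcendental hk ⟨k, rfl⟩

/-! ## §1  Conjugation and the six exponentials theorem in «all algebraic is impossible» form -/

/-- The complex conjugate of an algebraic number is algebraic (complex conjugation is the `ℚ`-algebra
endomorphism `(starRingEnd ℂ).toRatAlgHom`; as in `Theorems/SoloBlindConjugationRung.lean`). -/
theorem isAlgebraic_conj {z : ℂ} (hz : IsAlgebraic ℚ z) : IsAlgebraic ℚ (conj z) :=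
  hz.algHom (starRingEnd ℂ).toRatAlgHom

/-- `conj w ∈ ℚ̄ ↔ w ∈ ℚ̄`. -/
theorem isAlgebraic_conj_iff {w : ℂ} : IsAlgebraic ℚ (conj w) ↔ IsAlgebraic ℚ w := by
  refine ⟨fun h => ?_, isAlgebraic_conj⟩
  simpa using isAlgebraic_conj h

/-- `e^{conj u}` is algebraic iff `e^u` is (`e^{conj u} = conj e^u`). -/
theorem isAlgebraic_exp_conj_iff {u : ℂ} : IsAlgebraic ℚ (cexp (conj u)) ↔ IsAlgebraic ℚ (cexp u) := by
  rw [Complex.exp_conj, isAlgebraic_conj_iff]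

/-- **Six exponentials**, contrapositive form: a ℚ-free `2 × 3` grid cannot have all six values `e^{xᵢyⱼ}` algebraic
(tree theorem `six_exponentials_holds`, Lang 1966 Ch. II §1 Thm 1; Waldschmidt 2000 §1.3). -/
theorem grid_not_all_algebraic (x : Fin 2 → ℂ) (y : Fin 3 → ℂ) (hx : LinearIndependent ℚ x)
    (hy : LinearIndependent ℚ y) (h : ∀ i j, IsAlgebraic ℚ (cexp (x i * y j))) : False := by
  obtain ⟨i, j, hij⟩ := six_exponentials_holds x y hx hy
  exact hij (h i j)

/-- **A PROVED CASE OF THE FOUR EXPONENTIALS CONJECTURE** [Diaz2004 Thm 1, with his hypothesis «`y` non-real,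
`Re y ∉ ℚ`» replaced by the ℚ-freeness it serves to prove]: if `x₁, x₂ ∈ ℝ ∪ iℝ` (`conj xᵢ = ±xᵢ`, signs
independent) are ℚ-free and `(y₁, y₂, conj y₁)` is ℚ-free, then one of the four numbers `e^{xᵢyⱼ}` is transcendental.
Proof: six exponentials on the grid `(x₁, x₂) × (y₁, y₂, conj y₁)`, whose two extra values `e^{xᵢ conj y₁} =
(conj e^{xᵢy₁})^{±1}` are algebraic with the others.  The conclusion has the shape of the tree's registered
`FourExponentialsConjecture` (`∀ x y, LinearIndependent ℚ x → LinearIndependent ℚ y → ∃ i j, Transcendental ℚ (cexp (x i * y j))`)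
restricted to this cell — the registered input that re-arms lens 1 (critic STANDING (xi) (β)). -/
theorem fourExponentials_of_conj_axes (x y : Fin 2 → ℂ) (hxσ : ∀ i, conj (x i) = x i ∨ conj (x i) = -x i)
    (hx : LinearIndependent ℚ x) (hy : LinearIndependent ℚ ![y 0, y 1, conj (y 0)]) :
    ∃ i j, Transcendental ℚ (cexp (x i * y j)) := by
  by_contra hne
  simp only [not_exists, Transcendental, not_not] at hne
  have hconj : ∀ i, IsAlgebraic ℚ (cexp (x i * conj (y 0))) := fun i => by
    rcases hxσ i with h | h
    · have e : x i * conj (y 0) = conj (x i * y 0) := by rw [map_mul, h]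
      rw [e]
      exact isAlgebraic_exp_conj_iff.mpr (hne i 0)
    · have e : x i * conj (y 0) = -conj (x i * y 0) := by rw [map_mul, h]; ring
      rw [e, Complex.exp_neg]
      exact (isAlgebraic_exp_conj_iff.mpr (hne i 0)).inv
  refine grid_not_all_algebraic x ![y 0, y 1, conj (y 0)] hx hy ?_
  intro i j
  fin_cases j
  · simpa using hne i 0
  · simpa using hne i 1
  · simpa using hconj i

/-! ### The general instrument: the σ-grid lemma -/

/-- If every `e^{w i}` is algebraic then `e^u` is algebraic for every `u` in the ℚ-span of `w`
(`e^{Nu} ∈ ℚ(e^w)`, an algebraic extension of `ℚ`, and `N`-th roots of algebraic numbers are algebraic). -/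
theorem isAlgebraic_exp_of_mem_span {ι : Type*} {w : ι → ℂ} (hw : ∀ i, IsAlgebraic ℚ (cexp (w i))) {u : ℂ}
    (hu : u ∈ Submodule.span ℚ (Set.range w)) : IsAlgebraic ℚ (cexp u) := by
  obtain ⟨N, hN, hNu⟩ := exists_nsmul_mem_span_int w hu
  have hmem : cexp ((N : ℚ) • u) ∈ adjoin ℚ (Set.range (cexp ∘ w)) := exp_mem_vals_of_mem_span_int w hNu
  have hK : Algebra.IsAlgebraic ℚ ↥(adjoin ℚ (Set.range (cexp ∘ w))) := by
    apply IntermediateField.isAlgebraic_adjoin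
    rintro _ ⟨i, rfl⟩
    exact (hw i).isIntegral
  have h1 : IsAlgebraic ℚ (cexp ((N : ℚ) • u)) :=
    IntermediateField.isAlgebraic_iff.mp (hK.isAlgebraic ⟨_, hmem⟩)
  have hpow : cexp ((N : ℚ) • u) = cexp u ^ N := by
    rw [Nat.cast_smul_eq_nsmul, nsmul_eq_mul, Complex.exp_nat_mul]
  rw [hpow] at h1
  exact IsAlgebraic.of_pow (Nat.pos_of_ne_zero hN) h1

/-- **THE σ-GRID LEMMA (the instrument of this round).**  If all values `e^{w i}` are algebraic, then NO ℚ-free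
`2 × 3` grid `xᵢyⱼ` fits into the `σ`-saturated span `span_ℚ(w) + σ·span_ℚ(w) = span_ℚ(w, conj w)`: conjugation
keeps the values algebraic (`e^{conj u} = conj e^u`), spans keep them algebraic (previous lemma), and six
exponentials forbids an all-algebraic grid.  Families F_R and F_U below are the two ways an arg-rich power plane
`y₀(1, ρ, ρ²)` can host such a grid. [Diaz2004 Thm 1, mechanism; six exponentials: Lang1966 II §1 Thm 1] -/
theorem sigmaGrid_not_all_algebraic {ι : Type*} {w : ι → ℂ} (hw : ∀ i, IsAlgebraic ℚ (cexp (w i)))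
    (x : Fin 2 → ℂ) (y : Fin 3 → ℂ) (hx : LinearIndependent ℚ x) (hy : LinearIndependent ℚ y)
    (hgrid : ∀ i j, x i * y j ∈ Submodule.span ℚ (Set.range w ∪ Set.range (conj ∘ w))) : False := by
  have hw' : ∀ s, IsAlgebraic ℚ (cexp (Sum.elim w (conj ∘ w) s)) := by
    rintro (i | i)
    · simpa using hw i
    · simpa using isAlgebraic_exp_conj_iff.mpr (hw i)
  refine grid_not_all_algebraic x y hx hy fun i j => isAlgebraic_exp_of_mem_span hw' ?_
  rw [Set.Sum.elim_range]
  exact hgrid i j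

/-! ## §2  THE CONJUGATE SIEVE on power planes

### F_R: real or imaginary multiplier `ρ` (`conj ρ = ±ρ`), `σ`-oblique base -/

/-- **CONJUGATE SIEVE, family F_R.**  If `conj ρ = ±ρ`, `(1, ρ)` is ℚ-free and `(y₀, y₀ρ, conj y₀)` is ℚ-free, then
one of `e^{y₀}, e^{y₀ρ}, e^{y₀ρ²}` is transcendental: otherwise the grid `(1, ρ) × (y₀, y₀ρ, conj y₀)`, whose values
are `e^{y₀}, e^{y₀ρ}, conj e^{y₀}, e^{y₀ρ}, e^{y₀ρ²}, (conj e^{y₀ρ})^{±1}`, contradicts six exponentials.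
[Diaz2004 Thm 1, transplanted from Schneider's problem to power planes] -/
theorem exists_transcendental_exp_powerPlane_of_conj {y₀ ρ : ℂ} (hρ : conj ρ = ρ ∨ conj ρ = -ρ)
    (hx : LinearIndependent ℚ ![(1 : ℂ), ρ]) (hy : LinearIndependent ℚ ![y₀, y₀ * ρ, conj y₀]) :
    ∃ k, Transcendental ℚ (cexp (powerPlane y₀ ρ k)) := by
  by_contra hne
  simp only [not_exists, Transcendental, not_not] at hne
  have halg : ∀ k, IsAlgebraic ℚ (cexp (powerPlane y₀ ρ k)) := hne
  have a0 : IsAlgebraic ℚ (cexp y₀) := by simpa using halg 0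
  have a1 : IsAlgebraic ℚ (cexp (y₀ * ρ)) := by simpa using halg 1
  have a2 : IsAlgebraic ℚ (cexp (y₀ * ρ ^ 2)) := by simpa using halg 2
  have a0' : IsAlgebraic ℚ (cexp (conj y₀)) := isAlgebraic_exp_conj_iff.mpr a0
  have a1' : IsAlgebraic ℚ (cexp (ρ * conj y₀)) := by
    rcases hρ with h | h
    · have e : ρ * conj y₀ = conj (y₀ * ρ) := by rw [map_mul, h, mul_comm]
      rw [e]
      exact isAlgebraic_exp_conj_iff.mpr a1
    · have e : ρ * conj y₀ = -conj (y₀ * ρ) := by rw [map_mul, h]; ring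
      rw [e, Complex.exp_neg]
      exact (isAlgebraic_exp_conj_iff.mpr a1).inv
  refine grid_not_all_algebraic ![1, ρ] ![y₀, y₀ * ρ, conj y₀] hx hy ?_
  intro i j
  fin_cases i <;> fin_cases j
  · simpa using a0
  · simpa using a1
  · simpa using a0'
  · simpa [mul_comm] using a1
  · have e : ρ * (y₀ * ρ) = y₀ * ρ ^ 2 := by ring
    simpa [e] using a2
  · simpa using a1'

/-- The ℚ-freeness hypothesis of F_R in geometric terms: for REAL `ρ` with `(1, ρ)` ℚ-free and `y₀ ∉ ℝ ∪ iℝ`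
(`Re y₀ ≠ 0`, `Im y₀ ≠ 0`), the triple `(y₀, y₀ρ, conj y₀)` is ℚ-free. -/
theorem linearIndependent_triple_of_oblique {y₀ ρ : ℂ} (hre : y₀.re ≠ 0) (him : y₀.im ≠ 0)
    (hρ : conj ρ = ρ) (hx : LinearIndependent ℚ ![(1 : ℂ), ρ]) :
    LinearIndependent ℚ ![y₀, y₀ * ρ, conj y₀] := by
  have hρim : ρ.im = 0 := Complex.conj_eq_iff_im.mp hρ
  rw [Fintype.linearIndependent_iff]
  intro g hg
  have hsum : (g 0 : ℂ) * y₀ + (g 1 : ℂ) * (y₀ * ρ) + (g 2 : ℂ) * conj y₀ = 0 := by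
    simpa [Fin.sum_univ_three, Rat.smul_def] using hg
  have hre' := congrArg Complex.re hsum
  have him' := congrArg Complex.im hsum
  simp only [Complex.add_re, Complex.mul_re, Complex.ratCast_re, Complex.ratCast_im, zero_mul, sub_zero,
    Complex.conj_re, Complex.zero_re, Complex.add_im, Complex.mul_im, add_zero, Complex.conj_im,
    Complex.zero_im, hρim, mul_zero] at hre' him'
  -- hre' : g0*re + g1*(re*ρre) + g2*re = 0 ;  him' : g0*im + g1*(im*ρre) - g2*im = 0
  have h1 : ((g 0 : ℝ) + (g 1 : ℝ) * ρ.re + (g 2 : ℝ)) * y₀.re = 0 := by linear_combination hre'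
  have h2 : ((g 0 : ℝ) + (g 1 : ℝ) * ρ.re - (g 2 : ℝ)) * y₀.im = 0 := by linear_combination him'
  have h1' := (mul_eq_zero.mp h1).resolve_right hre
  have h2' := (mul_eq_zero.mp h2).resolve_right him
  have hg2 : (g 2 : ℝ) = 0 := by linear_combination (h1' - h2') / 2
  have hlin : (g 0 : ℝ) + (g 1 : ℝ) * ρ.re = 0 := by linear_combination (h1' + h2') / 2
  -- transport the real relation to `ℂ` and use the ℚ-freeness of `(1, ρ)`
  have hρre : (ρ.re : ℂ) = ρ := Complex.conj_eq_iff_re.mp hρ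
  have hlinC : (g 0 : ℂ) * 1 + (g 1 : ℂ) * ρ = 0 := by
    rw [← hρre, mul_one]
    have := congrArg (fun r : ℝ => (r : ℂ)) hlin
    simpa using this
  have h01 := Fintype.linearIndependent_iff.mp hx ![g 0, g 1] (by
    simpa [Fin.sum_univ_two, Rat.smul_def] using hlinC)
  have hg0 : g 0 = 0 := by simpa using h01 0
  have hg1 : g 1 = 0 := by simpa using h01 1
  have hg2' : g 2 = 0 := by exact_mod_cast hg2
  intro i
  fin_cases i
  · exact hg0
  · exact hg1
  · exact hg2'

/-! ### F_U: unimodular multiplier `ρ = conj y₀ / y₀` -/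

/-- **Diaz' conjugate variant of four exponentials** [Diaz2004, p. 538 «Variante»]: if `(x, conj x)` and
`(1, ρ, conj ρ)` are ℚ-free then one of `e^x, e^{xρ}, e^{(conj x)ρ}` is transcendental — six exponentials on the grid
`(x, conj x) × (1, ρ, conj ρ)`, whose values are these three numbers and their conjugates. -/
theorem diaz_conj_variant (x ρ : ℂ) (hx : LinearIndependent ℚ ![x, conj x])
    (hρ : LinearIndependent ℚ ![(1 : ℂ), ρ, conj ρ]) :
    Transcendental ℚ (cexp x) ∨ Transcendental ℚ (cexp (x * ρ)) ∨ Transcendental ℚ (cexp (conj x * ρ)) := by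
  by_contra h
  simp only [not_or, Transcendental, not_not] at h
  obtain ⟨b0, b1, b2⟩ := h
  have b0' : IsAlgebraic ℚ (cexp (conj x)) := isAlgebraic_exp_conj_iff.mpr b0
  have b1' : IsAlgebraic ℚ (cexp (conj x * conj ρ)) := by
    rw [← map_mul]
    exact isAlgebraic_exp_conj_iff.mpr b1
  have b2' : IsAlgebraic ℚ (cexp (x * conj ρ)) := by
    have e : x * conj ρ = conj (conj x * ρ) := by rw [map_mul, Complex.conj_conj]
    rw [e]
    exact isAlgebraic_exp_conj_iff.mpr b2
  refine grid_not_all_algebraic ![x, conj x] ![1, ρ, conj ρ] hx hρ ?_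
  intro i j
  fin_cases i <;> fin_cases j
  · simpa using b0
  · simpa using b1
  · simpa using b2'
  · simpa using b0'
  · simpa using b2
  · simpa using b1'

/-- **CONJUGATE SIEVE, family F_U.**  For `ρ = conj y₀ / y₀` (so `|ρ| = 1`) the power plane `y₀·(1, ρ, ρ²) =
(y₀, conj y₀, (conj y₀)²/y₀)`; if `(y₀, conj y₀)` and `(1, ρ, conj ρ)` are ℚ-free, one of its three values is
transcendental. -/
theorem exists_transcendental_exp_powerPlane_unimodular {y₀ : ℂ} (hX : LinearIndependent ℚ ![y₀, conj y₀])
    (hY : LinearIndependent ℚ ![(1 : ℂ), conj y₀ / y₀, y₀ / conj y₀]) :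
    ∃ k, Transcendental ℚ (cexp (powerPlane y₀ (conj y₀ / y₀) k)) := by
  have hy0 : y₀ ≠ 0 := by simpa using hX.ne_zero 0
  have hy0' : conj y₀ ≠ 0 := by simpa using hX.ne_zero 1
  have hconj : conj (conj y₀ / y₀) = y₀ / conj y₀ := by rw [map_div₀, Complex.conj_conj]
  have hY' : LinearIndependent ℚ ![(1 : ℂ), conj y₀ / y₀, conj (conj y₀ / y₀)] := by rwa [hconj]
  rcases diaz_conj_variant y₀ (conj y₀ / y₀) hX hY' with h | h | h
  · exact ⟨0, by simpa using h⟩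
  · exact ⟨1, by simpa using h⟩
  · refine ⟨2, ?_⟩
    have e : y₀ * (conj y₀ / y₀) ^ 2 = conj y₀ * (conj y₀ / y₀) := by
      field_simp
    simpa [e] using h

end Summit.Schanuel.Schanuel.Theorems.RootDecomp1ConjugateSieve
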